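import Mathlib.Analysis.SpecificLimits.Normed
import Mathlib.Analysis.Normed.Group.InfiniteSum
import Mathlib.Topology.Algebra.InfiniteSum.NatInt
import HarnessLib

/-!
# Convolution of two sequences with geometric approach to constants: `(a ∗ b)_k = AB·(k+1) + (A·Σ(b−B) + B·Σ(a−A)) + O((k+1)R^k)`,
# with EXPLICIT constants (module «CONVOLUTION ASYMPTOTICS», first-order)

Topic `Literature/Analysis/Asymptotics` (companion of `LinearRecurrenceDeflation.lean` / `LinearRecurrenceDominantRoot.lean`: those give, for the coefficient
sequence of a rational function with a dominant SIMPLE pole, `a_k → A` at an explicit geometric rate; this file composes such sequences).  Lane «pcv-sawmu»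
(CriticalPhenomena venture), a-p2 g26 — abstract input of the lineage's next car «WIDTH-TWO VARIANCE RATE» (DESIGN `HOME/pub-sawmu-a-p2/g26/DESIGN-VARIANCE-RATE-T2.md`):
the first and second contact moments of long strip bridges are convolutions (in the length) of bridge sums with a simple pole at the critical point, and a linear
variance law needs their asymptotics to ORDER ONE (the constant term), not just the leading order.  Source of the TEMPLATE: R. P. Stanley, *Enumerative Combinatorics*
I (2012) §4.1, Theorem 4.1.1 (iii) (coefficient asymptotics of rational functions; a double pole gives a linear polynomial) and W. Feller I (1968) XIII.6 (second
moments of renewal counts).  Nothing below is printed as such; it is the lane's explicit-constant arrangement.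

## What is proved (namespace `Literature.Analysis`)

* `cauchyProdCoeff a b k = Σ_{i ≤ k} a_i b_{k−i}` (the Cauchy product coefficient) and its algebra (`cauchyProdCoeff_eq_sum_sub`).
* `summable_of_abs_le_geometric`, `abs_tsum_nat_add_le_geometric` — a sequence with `|α_k| ≤ C R^k`, `0 ≤ R < 1`, is summable and its tails satisfy
  `|Σ_{i ≥ k} α_i| ≤ C R^k/(1 − R)`.
* ★★ **`abs_cauchyProdCoeff_sub_le`** — if `|a_k − A| ≤ C_a R^k` and `|b_k − B| ≤ C_b R^k` for all `k` (`0 ≤ R < 1`), then for every `k`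
  `|(a ∗ b)_k − (A·B·(k+1) + A·Σ' j (b_j − B) + B·Σ' i (a_i − A))| ≤ (|A|·C_b + |B|·C_a)·R^{k+1}/(1 − R) + C_a·C_b·(k+1)·R^k`;
  ★ `tendsto_cauchyProdCoeff_sub_linear` — hence `(a ∗ b)_k − A·B·(k+1) → A·Σ'(b − B) + B·Σ'(a − A)`.

* `abs_tsum_nat_add_le_geometric_linear` — tails of a sequence with `|γ_i| ≤ C (i+1) R^i`: `|Σ' j, γ_{j+m}| ≤ C (m+2) R^m/(1 − R)²`.
* ★★ **`abs_cauchyProdCoeff_sub_le_two`** (second order) — if `|a_k − (A₁(k+1) + A₀)| ≤ C_a (k+1) R^k` and `|b_k − B| ≤ C_b R^k`, then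
  `(a ∗ b)_k = (A₁B/2)(k+1)(k+2) + (A₀B + A₁Σ'β)(k+1) + (A₀Σ'β − A₁Σ' jβ_j + BΣ'α) + ERR_k` with
  `|ERR_k| ≤ |A₁|C_b(k+1)R^{k+1}/(1−R) + |A₁|C_b(k+3)R^{k+1}/(1−R)² + |A₀|C_bR^{k+1}/(1−R) + |B|C_a(k+3)R^{k+1}/(1−R)² + C_aC_b(k+1)(k+2)R^k/2`
  (`α = a − A₁(·+1) − A₀`, `β = b − B`) — the input for the SQUARED-contact sums of the variance design.

Label: LANE TOOL (own arrangement, a-p2 g26, 2026-08-27).  NOT claimed: anything model-specific (the strip instances are the next cars).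
-/

noncomputable section

open Filter Topology Finset

namespace Literature.Analysis

/-- The Cauchy-product coefficient of two real sequences: `(a ∗ b)_k = Σ_{i ≤ k} a_i · b_{k−i}`.
[cite: Stanley2012EC1, §4.1 Theorem 4.1.1 (iii) (lane tool)] -/
def cauchyProdCoeff (a b : ℕ → ℝ) (k : ℕ) : ℝ := ∑ i ∈ range (k + 1), a i * b (k - i)

/-- Algebra of the convolution against constants: with `α = a − A`, `β = b − B`,
`(a ∗ b)_k = A·B·(k+1) + A·Σ_{j ≤ k} β_j + B·Σ_{i ≤ k} α_i + Σ_{i ≤ k} α_i β_{k−i}`. [cite: Stanley2012EC1, §4.1 (lane tool)] -/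
theorem cauchyProdCoeff_eq_sum_sub (a b : ℕ → ℝ) (A B : ℝ) (k : ℕ) :
    cauchyProdCoeff a b k = A * B * ((k : ℝ) + 1) + A * ∑ j ∈ range (k + 1), (b j - B) + B * ∑ i ∈ range (k + 1), (a i - A)
      + ∑ i ∈ range (k + 1), (a i - A) * (b (k - i) - B) := by
  unfold cauchyProdCoeff
  have hrefl : ∑ i ∈ range (k + 1), (b (k - i) - B) = ∑ j ∈ range (k + 1), (b j - B) := by
    have := Finset.sum_range_reflect (fun j => b j - B) (k + 1)
    simpa using this
  have hexp : ∀ i ∈ range (k + 1), a i * b (k - i) = A * B + A * (b (k - i) - B) + B * (a i - A) + (a i - A) * (b (k - i) - B) := by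
    intro i _; ring
  rw [Finset.sum_congr rfl hexp, Finset.sum_add_distrib, Finset.sum_add_distrib, Finset.sum_add_distrib, Finset.sum_const, Finset.card_range,
    ← Finset.mul_sum, ← Finset.mul_sum, hrefl]
  simp only [nsmul_eq_mul, Nat.cast_add, Nat.cast_one]
  ring

/-- A sequence dominated by a geometric one is summable. [cite: Stanley2012EC1, §4.1 (lane tool)] -/
theorem summable_of_abs_le_geometric {α : ℕ → ℝ} {C R : ℝ} (hR0 : 0 ≤ R) (hR1 : R < 1) (h : ∀ k, |α k| ≤ C * R ^ k) : Summable α :=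
  Summable.of_norm_bounded ((summable_geometric_of_lt_one hR0 hR1).mul_left C) fun k => by rw [Real.norm_eq_abs]; exact h k

/-- Geometric tails: `|Σ' i, α_{i+k}| ≤ C·R^k/(1 − R)` when `|α_i| ≤ C R^i`, `0 ≤ R < 1`. [cite: Stanley2012EC1, §4.1 (lane tool)] -/
theorem abs_tsum_nat_add_le_geometric {α : ℕ → ℝ} {C R : ℝ} (hR0 : 0 ≤ R) (hR1 : R < 1) (h : ∀ k, |α k| ≤ C * R ^ k) (k : ℕ) :
    |∑' i, α (i + k)| ≤ C * R ^ k / (1 - R) := by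
  have hgeo := summable_geometric_of_lt_one hR0 hR1
  have hshift : ∀ i, |α (i + k)| ≤ C * R ^ k * R ^ i := fun i => by
    have := h (i + k); rw [pow_add] at this; linarith [this]
  have hsum_abs : Summable fun i => |α (i + k)| :=
    Summable.of_nonneg_of_le (fun i => abs_nonneg _) hshift (hgeo.mul_left _)
  have h1 : |∑' i, α (i + k)| ≤ ∑' i, |α (i + k)| := by
    have := norm_tsum_le_tsum_norm (f := fun i => α (i + k)) (by simpa [Real.norm_eq_abs] using hsum_abs)
    simpa [Real.norm_eq_abs] using this
  have h2 : ∑' i, |α (i + k)| ≤ ∑' i, C * R ^ k * R ^ i := hsum_abs.tsum_le_tsum hshift (hgeo.mul_left _)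
  have h3 : ∑' i : ℕ, C * R ^ k * R ^ i = C * R ^ k / (1 - R) := by
    rw [tsum_mul_left, tsum_geometric_of_lt_one hR0 hR1, div_eq_mul_inv]
  linarith [h3 ▸ h2]

/-- ★★ **First-order asymptotics of a convolution**: if `|a_k − A| ≤ C_a R^k` and `|b_k − B| ≤ C_b R^k` (`0 ≤ R < 1`), then for every `k`
`|(a ∗ b)_k − (A·B·(k+1) + A·Σ' j (b_j − B) + B·Σ' i (a_i − A))| ≤ (|A|·C_b + |B|·C_a)·R^{k+1}/(1 − R) + C_a·C_b·(k+1)·R^k`.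
(The two `Σ'` are the full sums of the summable deviations; the tails cost the first term, the cross term `Σ α_i β_{k−i}` the second.)
[cite: Stanley2012EC1, §4.1 Theorem 4.1.1 (iii); Feller1968, XIII.6; lane «pcv-sawmu» a-p2 g26 — own arrangement] -/
theorem abs_cauchyProdCoeff_sub_le {a b : ℕ → ℝ} {A B Ca Cb R : ℝ} (hR0 : 0 ≤ R) (hR1 : R < 1)
    (ha : ∀ k, |a k - A| ≤ Ca * R ^ k) (hb : ∀ k, |b k - B| ≤ Cb * R ^ k) (k : ℕ) :
    |cauchyProdCoeff a b k - (A * B * ((k : ℝ) + 1) + A * ∑' j, (b j - B) + B * ∑' i, (a i - A))|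
      ≤ (|A| * Cb + |B| * Ca) * R ^ (k + 1) / (1 - R) + Ca * Cb * ((k : ℝ) + 1) * R ^ k := by
  set α : ℕ → ℝ := fun i => a i - A with hα
  set β : ℕ → ℝ := fun j => b j - B with hβ
  have hαs : Summable α := summable_of_abs_le_geometric hR0 hR1 ha
  have hβs : Summable β := summable_of_abs_le_geometric hR0 hR1 hb
  -- split the full sums into the partial sums up to `k` and the tails
  have hαsplit : ∑' i, α i = ∑ i ∈ range (k + 1), α i + ∑' i, α (i + (k + 1)) := (hαs.sum_add_tsum_nat_add (k + 1)).symm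
  have hβsplit : ∑' j, β j = ∑ j ∈ range (k + 1), β j + ∑' j, β (j + (k + 1)) := (hβs.sum_add_tsum_nat_add (k + 1)).symm
  have htailα := abs_tsum_nat_add_le_geometric hR0 hR1 ha (k + 1)
  have htailβ := abs_tsum_nat_add_le_geometric hR0 hR1 hb (k + 1)
  -- the cross term
  have hcross : |∑ i ∈ range (k + 1), α i * β (k - i)| ≤ Ca * Cb * ((k : ℝ) + 1) * R ^ k := by
    calc |∑ i ∈ range (k + 1), α i * β (k - i)| ≤ ∑ i ∈ range (k + 1), |α i * β (k - i)| := Finset.abs_sum_le_sum_abs _ _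
      _ ≤ ∑ i ∈ range (k + 1), Ca * Cb * R ^ k := by
          refine Finset.sum_le_sum fun i hi => ?_
          rw [Finset.mem_range] at hi
          rw [abs_mul]
          have h1 := ha i
          have h2 := hb (k - i)
          have hpow : R ^ i * R ^ (k - i) = R ^ k := by rw [← pow_add]; congr 1; omega
          calc |α i| * |β (k - i)| ≤ (Ca * R ^ i) * (Cb * R ^ (k - i)) :=
                mul_le_mul h1 h2 (abs_nonneg _) (le_trans (abs_nonneg _) h1)
            _ = Ca * Cb * R ^ k := by rw [← hpow]; ring
      _ = Ca * Cb * ((k : ℝ) + 1) * R ^ k := by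
          rw [Finset.sum_const, Finset.card_range]; simp only [nsmul_eq_mul, Nat.cast_add, Nat.cast_one]; ring
  -- assemble
  rw [cauchyProdCoeff_eq_sum_sub a b A B k, hαsplit, hβsplit]
  have hA : |A * ∑' j, β (j + (k + 1))| ≤ |A| * (Cb * R ^ (k + 1) / (1 - R)) := by
    rw [abs_mul]; exact mul_le_mul_of_nonneg_left htailβ (abs_nonneg _)
  have hB : |B * ∑' i, α (i + (k + 1))| ≤ |B| * (Ca * R ^ (k + 1) / (1 - R)) := by
    rw [abs_mul]; exact mul_le_mul_of_nonneg_left htailα (abs_nonneg _)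
  have key : (A * B * ((k : ℝ) + 1) + A * ∑ j ∈ range (k + 1), β j + B * ∑ i ∈ range (k + 1), α i
        + ∑ i ∈ range (k + 1), α i * β (k - i))
      - (A * B * ((k : ℝ) + 1) + A * (∑ j ∈ range (k + 1), β j + ∑' j, β (j + (k + 1)))
        + B * (∑ i ∈ range (k + 1), α i + ∑' i, α (i + (k + 1))))
      = ∑ i ∈ range (k + 1), α i * β (k - i) - A * ∑' j, β (j + (k + 1)) - B * ∑' i, α (i + (k + 1)) := by ring
  rw [key]
  have h1R : 0 < 1 - R := by linarith
  calc |∑ i ∈ range (k + 1), α i * β (k - i) - A * ∑' j, β (j + (k + 1)) - B * ∑' i, α (i + (k + 1))|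
      ≤ |∑ i ∈ range (k + 1), α i * β (k - i)| + |A * ∑' j, β (j + (k + 1))| + |B * ∑' i, α (i + (k + 1))| := by
        have := abs_sub (∑ i ∈ range (k + 1), α i * β (k - i) - A * ∑' j, β (j + (k + 1))) (B * ∑' i, α (i + (k + 1)))
        have := abs_sub (∑ i ∈ range (k + 1), α i * β (k - i)) (A * ∑' j, β (j + (k + 1)))
        linarith
    _ ≤ Ca * Cb * ((k : ℝ) + 1) * R ^ k + |A| * (Cb * R ^ (k + 1) / (1 - R)) + |B| * (Ca * R ^ (k + 1) / (1 - R)) := by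
        linarith [hcross, hA, hB]
    _ = (|A| * Cb + |B| * Ca) * R ^ (k + 1) / (1 - R) + Ca * Cb * ((k : ℝ) + 1) * R ^ k := by
        field_simp
        ring

/-- ★ **The convolution minus its linear part converges**: under the hypotheses of `abs_cauchyProdCoeff_sub_le`,
`(a ∗ b)_k − A·B·(k+1) → A·Σ' j (b_j − B) + B·Σ' i (a_i − A)`. [cite: Stanley2012EC1, §4.1 Theorem 4.1.1 (iii); lane «pcv-sawmu» a-p2 g26 — own arrangement] -/
theorem tendsto_cauchyProdCoeff_sub_linear {a b : ℕ → ℝ} {A B Ca Cb R : ℝ} (hR0 : 0 ≤ R) (hR1 : R < 1)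
    (ha : ∀ k, |a k - A| ≤ Ca * R ^ k) (hb : ∀ k, |b k - B| ≤ Cb * R ^ k) :
    Tendsto (fun k : ℕ => cauchyProdCoeff a b k - A * B * ((k : ℝ) + 1)) atTop
      (𝓝 (A * ∑' j, (b j - B) + B * ∑' i, (a i - A))) := by
  set L : ℝ := A * ∑' j, (b j - B) + B * ∑' i, (a i - A) with hL
  -- the error bound tends to zero
  have hgeo : Tendsto (fun k : ℕ => R ^ k) atTop (𝓝 0) := tendsto_pow_atTop_nhds_zero_of_lt_one hR0 hR1
  have hkgeo : Tendsto (fun k : ℕ => ((k : ℝ) + 1) * R ^ k) atTop (𝓝 0) := by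
    have h1 : Tendsto (fun k : ℕ => (k : ℝ) * R ^ k) atTop (𝓝 0) := by
      simpa using tendsto_self_mul_const_pow_of_lt_one hR0 hR1
    have : (fun k : ℕ => ((k : ℝ) + 1) * R ^ k) = fun k : ℕ => (k : ℝ) * R ^ k + R ^ k := by funext k; ring
    rw [this]
    simpa using h1.add hgeo
  have hbound : Tendsto (fun k : ℕ => (|A| * Cb + |B| * Ca) * R ^ (k + 1) / (1 - R) + Ca * Cb * ((k : ℝ) + 1) * R ^ k) atTop (𝓝 0) := by
    have h1 : Tendsto (fun k : ℕ => (|A| * Cb + |B| * Ca) * R ^ (k + 1) / (1 - R)) atTop (𝓝 0) := by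
      have := ((hgeo.comp (tendsto_add_atTop_nat 1)).const_mul (|A| * Cb + |B| * Ca)).div_const (1 - R)
      simpa using this
    have h2 : Tendsto (fun k : ℕ => Ca * Cb * ((k : ℝ) + 1) * R ^ k) atTop (𝓝 0) := by
      have := hkgeo.const_mul (Ca * Cb)
      simp only [mul_zero] at this
      refine this.congr fun k => ?_
      ring
    simpa using h1.add h2
  rw [Metric.tendsto_atTop]
  intro ε hε
  rw [Metric.tendsto_atTop] at hbound
  obtain ⟨N, hN⟩ := hbound ε hε
  refine ⟨N, fun k hk => ?_⟩
  have hk' := hN k hk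
  rw [Real.dist_eq, sub_zero] at hk'
  rw [Real.dist_eq]
  have hle := abs_cauchyProdCoeff_sub_le hR0 hR1 ha hb k
  have hnn : 0 ≤ (|A| * Cb + |B| * Ca) * R ^ (k + 1) / (1 - R) + Ca * Cb * ((k : ℝ) + 1) * R ^ k := le_trans (abs_nonneg _) hle
  rw [abs_of_nonneg hnn] at hk'
  calc |cauchyProdCoeff a b k - A * B * ((k : ℝ) + 1) - L|
      = |cauchyProdCoeff a b k - (A * B * ((k : ℝ) + 1) + A * ∑' j, (b j - B) + B * ∑' i, (a i - A))| := by rw [hL]; ring_nf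
    _ < ε := lt_of_le_of_lt hle hk'

/-! ## Second order: a linearly growing sequence against a converging one -/

/-- Weighted geometric tails: if `|γ_i| ≤ C (i+1) R^i` (`0 ≤ R < 1`) then `|Σ' j, γ_{j+m}| ≤ C (m+2) R^m/(1 − R)²` (plumbing; uses `Σ j R^j = R/(1−R)²`).
[cite: Stanley2012EC1, §4.1 (lane tool)] -/
theorem abs_tsum_nat_add_le_geometric_linear {γ : ℕ → ℝ} {C R : ℝ} (hR0 : 0 ≤ R) (hR1 : R < 1) (h : ∀ i, |γ i| ≤ C * ((i : ℝ) + 1) * R ^ i)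
    (m : ℕ) : |∑' j, γ (j + m)| ≤ C * ((m : ℝ) + 2) * R ^ m / (1 - R) ^ 2 := by
  have hnorm : ‖R‖ < 1 := by rw [Real.norm_eq_abs, abs_of_nonneg hR0]; exact hR1
  have hgeo := summable_geometric_of_lt_one hR0 hR1
  have hgeo1 : Summable fun n : ℕ => (n : ℝ) * R ^ n := by
    simpa using summable_pow_mul_geometric_of_norm_lt_one 1 hnorm
  have hC0 : 0 ≤ C := by
    have := h 0
    have h0 : (0 : ℝ) ≤ |γ 0| := abs_nonneg _
    simp at this
    linarith
  -- pointwise bound on the shifted sequence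
  have hshift : ∀ j : ℕ, |γ (j + m)| ≤ C * R ^ m * ((j : ℝ) * R ^ j) + C * R ^ m * ((m : ℝ) + 1) * R ^ j := fun j => by
    have := h (j + m)
    rw [pow_add] at this
    push_cast at this
    nlinarith [this, pow_nonneg hR0 j, pow_nonneg hR0 m]
  have hdom : Summable fun j : ℕ => C * R ^ m * ((j : ℝ) * R ^ j) + C * R ^ m * ((m : ℝ) + 1) * R ^ j :=
    (hgeo1.mul_left _).add (hgeo.mul_left _)
  have hsum_abs : Summable fun j => |γ (j + m)| := Summable.of_nonneg_of_le (fun j => abs_nonneg _) hshift hdom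
  have h1 : |∑' j, γ (j + m)| ≤ ∑' j, |γ (j + m)| := by
    have := norm_tsum_le_tsum_norm (f := fun j => γ (j + m)) (by simpa [Real.norm_eq_abs] using hsum_abs)
    simpa [Real.norm_eq_abs] using this
  have h2 : ∑' j, |γ (j + m)| ≤ ∑' j : ℕ, (C * R ^ m * ((j : ℝ) * R ^ j) + C * R ^ m * ((m : ℝ) + 1) * R ^ j) :=
    hsum_abs.tsum_le_tsum hshift hdom
  have h3 : ∑' j : ℕ, (C * R ^ m * ((j : ℝ) * R ^ j) + C * R ^ m * ((m : ℝ) + 1) * R ^ j)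
      = C * R ^ m * (R / (1 - R) ^ 2) + C * R ^ m * ((m : ℝ) + 1) * (1 - R)⁻¹ := by
    rw [(hgeo1.mul_left _).tsum_add (hgeo.mul_left _), tsum_mul_left, tsum_mul_left, tsum_coe_mul_geometric_of_norm_lt_one hnorm,
      tsum_geometric_of_lt_one hR0 hR1]
  have h1R : 0 < 1 - R := by linarith
  have h4 : C * R ^ m * (R / (1 - R) ^ 2) + C * R ^ m * ((m : ℝ) + 1) * (1 - R)⁻¹ ≤ C * ((m : ℝ) + 2) * R ^ m / (1 - R) ^ 2 := by
    have hCRm : 0 ≤ C * R ^ m := mul_nonneg hC0 (pow_nonneg hR0 m)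
    have key : C * R ^ m * (R / (1 - R) ^ 2) + C * R ^ m * ((m : ℝ) + 1) * (1 - R)⁻¹
        = (C * R ^ m * (R + ((m : ℝ) + 1) * (1 - R))) / (1 - R) ^ 2 := by
      field_simp
    rw [key]
    refine div_le_div_of_nonneg_right ?_ (by positivity)
    have hle : R + ((m : ℝ) + 1) * (1 - R) ≤ (m : ℝ) + 2 := by nlinarith [mul_nonneg (Nat.cast_nonneg m) hR0]
    calc C * R ^ m * (R + ((m : ℝ) + 1) * (1 - R)) ≤ C * R ^ m * ((m : ℝ) + 2) := mul_le_mul_of_nonneg_left hle hCRm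
      _ = C * ((m : ℝ) + 2) * R ^ m := by ring
  have h2' := h2
  rw [h3] at h2'
  linarith

/-- Bilinearity of the Cauchy product in the first argument (plumbing). [cite: Stanley2012EC1, §4.1 (lane tool)] -/
theorem cauchyProdCoeff_add_left (a a' b : ℕ → ℝ) (k : ℕ) :
    cauchyProdCoeff (fun i => a i + a' i) b k = cauchyProdCoeff a b k + cauchyProdCoeff a' b k := by
  unfold cauchyProdCoeff
  rw [← Finset.sum_add_distrib]
  exact Finset.sum_congr rfl fun i _ => by ring

/-- `Σ_{i ≤ k} (i+1) = (k+1)(k+2)/2` over `ℝ` (plumbing). [cite: Stanley2012EC1, §4.1 (lane tool)] -/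
theorem sum_range_succ_cast_add_one (k : ℕ) : ∑ i ∈ range (k + 1), ((i : ℝ) + 1) = ((k : ℝ) + 1) * ((k : ℝ) + 2) / 2 := by
  induction k with
  | zero => norm_num
  | succ n ih => rw [Finset.sum_range_succ, ih]; push_cast; ring

/-- Reflection with a linear weight: `Σ_{i ≤ k} (i+1)·β_{k−i} = (k+1)·Σ_{j ≤ k} β_j − Σ_{j ≤ k} j·β_j` (plumbing). [cite: Stanley2012EC1, §4.1 (lane tool)] -/
theorem sum_range_succ_linear_reflect (β : ℕ → ℝ) (k : ℕ) :
    ∑ i ∈ range (k + 1), ((i : ℝ) + 1) * β (k - i) = ((k : ℝ) + 1) * ∑ j ∈ range (k + 1), β j - ∑ j ∈ range (k + 1), (j : ℝ) * β j := by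
  have hrefl := Finset.sum_range_reflect (fun j : ℕ => (((k : ℝ) + 1) - (j : ℝ)) * β j) (k + 1)
  have hlhs : ∑ i ∈ range (k + 1), ((i : ℝ) + 1) * β (k - i) = ∑ i ∈ range (k + 1), (fun j : ℕ => (((k : ℝ) + 1) - (j : ℝ)) * β j) (k + 1 - 1 - i) := by
    refine Finset.sum_congr rfl fun i hi => ?_
    rw [Finset.mem_range] at hi
    have hki : k + 1 - 1 - i = k - i := by omega
    simp only [hki]
    rw [Nat.cast_sub (by omega : i ≤ k)]
    ring
  rw [hlhs, hrefl, Finset.mul_sum, ← Finset.sum_sub_distrib]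
  exact Finset.sum_congr rfl fun j _ => by ring

/-- Second-order algebra of the convolution: with `α_i = a_i − A₁(i+1) − A₀`, `β_j = b_j − B`,
`(a ∗ b)_k = (A₁B/2)(k+1)(k+2) + A₀B(k+1) + A₁((k+1)Σ_{j≤k}β_j − Σ_{j≤k} jβ_j) + A₀Σ_{j≤k}β_j + BΣ_{i≤k}α_i + Σ_{i≤k}α_iβ_{k−i}`.
[cite: Stanley2012EC1, §4.1 (lane tool)] -/
theorem cauchyProdCoeff_eq_sum_sub_two (a b : ℕ → ℝ) (A₁ A₀ B : ℝ) (k : ℕ) :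
    cauchyProdCoeff a b k = A₁ * B / 2 * ((k : ℝ) + 1) * ((k : ℝ) + 2) + A₀ * B * ((k : ℝ) + 1)
      + A₁ * (((k : ℝ) + 1) * ∑ j ∈ range (k + 1), (b j - B) - ∑ j ∈ range (k + 1), (j : ℝ) * (b j - B))
      + A₀ * ∑ j ∈ range (k + 1), (b j - B) + B * ∑ i ∈ range (k + 1), (a i - A₁ * ((i : ℝ) + 1) - A₀)
      + ∑ i ∈ range (k + 1), (a i - A₁ * ((i : ℝ) + 1) - A₀) * (b (k - i) - B) := by
  -- split `a = A₁(·+1) + (a − A₁(·+1))`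
  have hfun : (fun i : ℕ => A₁ * ((i : ℝ) + 1) + (a i - A₁ * ((i : ℝ) + 1))) = a := funext fun i => by ring
  have hsplit := cauchyProdCoeff_add_left (fun i : ℕ => A₁ * ((i : ℝ) + 1)) (fun i : ℕ => a i - A₁ * ((i : ℝ) + 1)) b k
  rw [hfun] at hsplit
  -- the linear part
  have hlin : cauchyProdCoeff (fun i : ℕ => A₁ * ((i : ℝ) + 1)) b k
      = A₁ * B / 2 * ((k : ℝ) + 1) * ((k : ℝ) + 2)
        + A₁ * (((k : ℝ) + 1) * ∑ j ∈ range (k + 1), (b j - B) - ∑ j ∈ range (k + 1), (j : ℝ) * (b j - B)) := by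
    unfold cauchyProdCoeff
    have hterm : ∀ i ∈ range (k + 1), A₁ * ((i : ℝ) + 1) * b (k - i) = A₁ * B * ((i : ℝ) + 1) + A₁ * (((i : ℝ) + 1) * (b (k - i) - B)) := by
      intro i _; ring
    rw [Finset.sum_congr rfl hterm, Finset.sum_add_distrib, ← Finset.mul_sum, ← Finset.mul_sum, sum_range_succ_cast_add_one,
      sum_range_succ_linear_reflect (fun j => b j - B) k]
    ring
  -- the remaining part by the first-order algebra with the constant `A₀`
  have hrest := cauchyProdCoeff_eq_sum_sub (fun i : ℕ => a i - A₁ * ((i : ℝ) + 1)) b A₀ B k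
  rw [hsplit, hlin, hrest]
  ring

/-- ★★ **Second-order asymptotics of a convolution**: if `|a_k − (A₁(k+1) + A₀)| ≤ C_a (k+1) R^k` and `|b_k − B| ≤ C_b R^k` (`0 ≤ R < 1`), then with
`Sβ = Σ' j (b_j − B)`, `Mβ = Σ' j, j·(b_j − B)`, `Sα = Σ' i (a_i − A₁(i+1) − A₀)`, for every `k`:
`|(a ∗ b)_k − ((A₁B/2)(k+1)(k+2) + (A₀B + A₁Sβ)(k+1) + (A₀Sβ − A₁Mβ + BSα))|`
`≤ |A₁|C_b(k+1)R^{k+1}/(1−R) + |A₁|C_b(k+3)R^{k+1}/(1−R)² + |A₀|C_bR^{k+1}/(1−R) + |B|C_a(k+3)R^{k+1}/(1−R)² + C_aC_b(k+1)(k+2)R^k/2`.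
[cite: Stanley2012EC1, §4.1 Theorem 4.1.1 (iii) (a triple pole gives a quadratic polynomial); Feller1968, XIII.6; lane «pcv-sawmu» a-p2 g26 — own arrangement] -/
theorem abs_cauchyProdCoeff_sub_le_two {a b : ℕ → ℝ} {A₁ A₀ B Ca Cb R : ℝ} (hR0 : 0 ≤ R) (hR1 : R < 1)
    (ha : ∀ k, |a k - (A₁ * ((k : ℝ) + 1) + A₀)| ≤ Ca * ((k : ℝ) + 1) * R ^ k) (hb : ∀ k, |b k - B| ≤ Cb * R ^ k) (k : ℕ) :
    |cauchyProdCoeff a b k - (A₁ * B / 2 * ((k : ℝ) + 1) * ((k : ℝ) + 2) + (A₀ * B + A₁ * ∑' j, (b j - B)) * ((k : ℝ) + 1)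
        + (A₀ * ∑' j, (b j - B) - A₁ * ∑' j : ℕ, (j : ℝ) * (b j - B) + B * ∑' i : ℕ, (a i - A₁ * ((i : ℝ) + 1) - A₀)))|
      ≤ |A₁| * Cb * ((k : ℝ) + 1) * R ^ (k + 1) / (1 - R) + |A₁| * Cb * ((k : ℝ) + 3) * R ^ (k + 1) / (1 - R) ^ 2
        + |A₀| * Cb * R ^ (k + 1) / (1 - R) + |B| * Ca * ((k : ℝ) + 3) * R ^ (k + 1) / (1 - R) ^ 2
        + Ca * Cb * ((k : ℝ) + 1) * ((k : ℝ) + 2) * R ^ k / 2 := by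
  set α : ℕ → ℝ := fun i : ℕ => a i - A₁ * ((i : ℝ) + 1) - A₀ with hα
  set β : ℕ → ℝ := fun j => b j - B with hβ
  set μ : ℕ → ℝ := fun j : ℕ => (j : ℝ) * (b j - B) with hμ
  have h1R : 0 < 1 - R := by linarith
  -- bounds
  have hαbound : ∀ i, |α i| ≤ Ca * ((i : ℝ) + 1) * R ^ i := fun i => by
    have := ha i
    have e : a i - (A₁ * ((i : ℝ) + 1) + A₀) = α i := by simp only [hα]; ring
    rwa [e] at this
  have hμbound : ∀ j, |μ j| ≤ Cb * ((j : ℝ) + 1) * R ^ j := fun j => by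
    simp only [hμ]
    rw [abs_mul, abs_of_nonneg (Nat.cast_nonneg j)]
    have := hb j
    have hj0 : (0 : ℝ) ≤ j := Nat.cast_nonneg j
    nlinarith [abs_nonneg (b j - B), pow_nonneg hR0 j]
  have hnorm : ‖R‖ < 1 := by rw [Real.norm_eq_abs, abs_of_nonneg hR0]; exact hR1
  have hlinsum : Summable fun n : ℕ => ((n : ℝ) + 1) * R ^ n := by
    have h1 : Summable fun n : ℕ => (n : ℝ) * R ^ n := by simpa using summable_pow_mul_geometric_of_norm_lt_one 1 hnorm
    have e : (fun n : ℕ => ((n : ℝ) + 1) * R ^ n) = fun n : ℕ => (n : ℝ) * R ^ n + R ^ n := by funext n; ring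
    rw [e]; exact h1.add (summable_geometric_of_lt_one hR0 hR1)
  have hβs : Summable β := summable_of_abs_le_geometric hR0 hR1 hb
  have hαs : Summable α := Summable.of_norm_bounded (hlinsum.mul_left Ca) fun i => by
    rw [Real.norm_eq_abs]; have := hαbound i; linarith [this]
  have hμs : Summable μ := Summable.of_norm_bounded (hlinsum.mul_left Cb) fun j => by
    rw [Real.norm_eq_abs]; have := hμbound j; linarith [this]
  -- splits
  have hαsplit : ∑' i, α i = ∑ i ∈ range (k + 1), α i + ∑' i, α (i + (k + 1)) := (hαs.sum_add_tsum_nat_add (k + 1)).symm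
  have hβsplit : ∑' j, β j = ∑ j ∈ range (k + 1), β j + ∑' j, β (j + (k + 1)) := (hβs.sum_add_tsum_nat_add (k + 1)).symm
  have hμsplit : ∑' j, μ j = ∑ j ∈ range (k + 1), μ j + ∑' j, μ (j + (k + 1)) := (hμs.sum_add_tsum_nat_add (k + 1)).symm
  -- tails
  have hTβ := abs_tsum_nat_add_le_geometric hR0 hR1 hb (k + 1)
  have hTμ := abs_tsum_nat_add_le_geometric_linear hR0 hR1 hμbound (k + 1)
  have hTα := abs_tsum_nat_add_le_geometric_linear hR0 hR1 hαbound (k + 1)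
  -- cross term
  have hcross : |∑ i ∈ range (k + 1), α i * β (k - i)| ≤ Ca * Cb * ((k : ℝ) + 1) * ((k : ℝ) + 2) * R ^ k / 2 := by
    calc |∑ i ∈ range (k + 1), α i * β (k - i)| ≤ ∑ i ∈ range (k + 1), |α i * β (k - i)| := Finset.abs_sum_le_sum_abs _ _
      _ ≤ ∑ i ∈ range (k + 1), Ca * Cb * R ^ k * ((i : ℝ) + 1) := by
          refine Finset.sum_le_sum fun i hi => ?_
          rw [Finset.mem_range] at hi
          rw [abs_mul]
          have h1 := hαbound i
          have h2 := hb (k - i)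
          have hpow : R ^ i * R ^ (k - i) = R ^ k := by rw [← pow_add]; congr 1; omega
          calc |α i| * |β (k - i)| ≤ (Ca * ((i : ℝ) + 1) * R ^ i) * (Cb * R ^ (k - i)) :=
                mul_le_mul h1 h2 (abs_nonneg _) (le_trans (abs_nonneg _) h1)
            _ = Ca * Cb * R ^ k * ((i : ℝ) + 1) := by rw [← hpow]; ring
      _ = Ca * Cb * ((k : ℝ) + 1) * ((k : ℝ) + 2) * R ^ k / 2 := by
          rw [← Finset.mul_sum, sum_range_succ_cast_add_one]; ring
  -- assemble
  rw [cauchyProdCoeff_eq_sum_sub_two a b A₁ A₀ B k, hαsplit, hβsplit, hμsplit]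
  have key : (A₁ * B / 2 * ((k : ℝ) + 1) * ((k : ℝ) + 2) + A₀ * B * ((k : ℝ) + 1)
      + A₁ * (((k : ℝ) + 1) * ∑ j ∈ range (k + 1), β j - ∑ j ∈ range (k + 1), μ j)
      + A₀ * ∑ j ∈ range (k + 1), β j + B * ∑ i ∈ range (k + 1), α i + ∑ i ∈ range (k + 1), α i * β (k - i))
      - (A₁ * B / 2 * ((k : ℝ) + 1) * ((k : ℝ) + 2) + (A₀ * B + A₁ * (∑ j ∈ range (k + 1), β j + ∑' j, β (j + (k + 1)))) * ((k : ℝ) + 1)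
      + (A₀ * (∑ j ∈ range (k + 1), β j + ∑' j, β (j + (k + 1))) - A₁ * (∑ j ∈ range (k + 1), μ j + ∑' j, μ (j + (k + 1)))
      + B * (∑ i ∈ range (k + 1), α i + ∑' i, α (i + (k + 1)))))
      = ∑ i ∈ range (k + 1), α i * β (k - i) - A₁ * ((k : ℝ) + 1) * ∑' j, β (j + (k + 1)) + A₁ * ∑' j, μ (j + (k + 1))
        - A₀ * ∑' j, β (j + (k + 1)) - B * ∑' i, α (i + (k + 1)) := by ring
  rw [key]
  have hk1 : (0 : ℝ) ≤ (k : ℝ) + 1 := by positivity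
  have e1 : |A₁ * ((k : ℝ) + 1) * ∑' j, β (j + (k + 1))| ≤ |A₁| * ((k : ℝ) + 1) * (Cb * R ^ (k + 1) / (1 - R)) := by
    rw [abs_mul, abs_mul, abs_of_nonneg hk1]; exact mul_le_mul_of_nonneg_left hTβ (by positivity)
  have e2 : |A₁ * ∑' j, μ (j + (k + 1))| ≤ |A₁| * (Cb * ((((k + 1 : ℕ)) : ℝ) + 2) * R ^ (k + 1) / (1 - R) ^ 2) := by
    rw [abs_mul]; exact mul_le_mul_of_nonneg_left hTμ (abs_nonneg _)
  have e3 : |A₀ * ∑' j, β (j + (k + 1))| ≤ |A₀| * (Cb * R ^ (k + 1) / (1 - R)) := by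
    rw [abs_mul]; exact mul_le_mul_of_nonneg_left hTβ (abs_nonneg _)
  have e4 : |B * ∑' i, α (i + (k + 1))| ≤ |B| * (Ca * ((((k + 1 : ℕ)) : ℝ) + 2) * R ^ (k + 1) / (1 - R) ^ 2) := by
    rw [abs_mul]; exact mul_le_mul_of_nonneg_left hTα (abs_nonneg _)
  have hcast : ((((k + 1 : ℕ)) : ℝ) + 2) = (k : ℝ) + 3 := by push_cast; ring
  rw [hcast] at e2 e4
  calc |∑ i ∈ range (k + 1), α i * β (k - i) - A₁ * ((k : ℝ) + 1) * ∑' j, β (j + (k + 1)) + A₁ * ∑' j, μ (j + (k + 1))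
        - A₀ * ∑' j, β (j + (k + 1)) - B * ∑' i, α (i + (k + 1))|
      ≤ |∑ i ∈ range (k + 1), α i * β (k - i)| + |A₁ * ((k : ℝ) + 1) * ∑' j, β (j + (k + 1))| + |A₁ * ∑' j, μ (j + (k + 1))|
        + |A₀ * ∑' j, β (j + (k + 1))| + |B * ∑' i, α (i + (k + 1))| := by
        have t1 := abs_sub (∑ i ∈ range (k + 1), α i * β (k - i) - A₁ * ((k : ℝ) + 1) * ∑' j, β (j + (k + 1)) + A₁ * ∑' j, μ (j + (k + 1))
          - A₀ * ∑' j, β (j + (k + 1))) (B * ∑' i, α (i + (k + 1)))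
        have t2 := abs_sub (∑ i ∈ range (k + 1), α i * β (k - i) - A₁ * ((k : ℝ) + 1) * ∑' j, β (j + (k + 1)) + A₁ * ∑' j, μ (j + (k + 1)))
          (A₀ * ∑' j, β (j + (k + 1)))
        have t3 := abs_add_le (∑ i ∈ range (k + 1), α i * β (k - i) - A₁ * ((k : ℝ) + 1) * ∑' j, β (j + (k + 1))) (A₁ * ∑' j, μ (j + (k + 1)))
        have t4 := abs_sub (∑ i ∈ range (k + 1), α i * β (k - i)) (A₁ * ((k : ℝ) + 1) * ∑' j, β (j + (k + 1)))
        linarith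
    _ ≤ Ca * Cb * ((k : ℝ) + 1) * ((k : ℝ) + 2) * R ^ k / 2 + |A₁| * ((k : ℝ) + 1) * (Cb * R ^ (k + 1) / (1 - R))
        + |A₁| * (Cb * ((k : ℝ) + 3) * R ^ (k + 1) / (1 - R) ^ 2) + |A₀| * (Cb * R ^ (k + 1) / (1 - R))
        + |B| * (Ca * ((k : ℝ) + 3) * R ^ (k + 1) / (1 - R) ^ 2) := by linarith [hcross, e1, e2, e3, e4]
    _ = _ := by ring

end Literature.Analysis
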